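import Mathlib
import Literature.NumberTheory.Transcendental.KZCalculusProofs
import Literature.NumberTheory.Transcendental.KZLogCalculusProofs
import Literature.NumberTheory.Transcendental.KZHomotopyMoves
import Literature.NumberTheory.Transcendental.KZSemialgebraicComplex
import Literature.NumberTheory.Transcendental.KZIntervalPeriodProofs
import Summits.KontsevichZagierPeriods.KontsevichZagierPeriods.Theorems.HyperbolicBlochOffTetraSectorKernelRungZeroLogRelations

/-!
# `OffTetraSectorKernel`, line `odd-hyperbolic-ladder` (v10): stub `stub_sphereRadial`

Stub `stub_sphereRadial` of the crux `OffTetraSectorKernel` (stmt-KontsevichZagierPeriods-10557,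
route HyperbolicBloch): the RADIAL INTEGRATION of the spherical rung — Girard's theorem inside the
Kontsevich–Zagier calculus.

In the stereographic chart the area density of the unit sphere is `4/(1 + x² + y²)²`; a great
circle avoiding the poles is rationally parametrised by
`p(τ) = (c₁ + R(1 − τ²)/(1 + τ²), c₂ + 2Rτ/(1 + τ²))` with `R² = 1 + c₁² + c₂²`, and the geodesic
fan from the south pole over the arc `p((τ₁, τ₂))` is the image of the rectangle
`(τ₁, τ₂) × (0, 1)` under `(τ, λ) ↦ λ p(τ)`, with pulled-back density `4λJ(τ)/(1 + λ²P(τ))²`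
(`J = p × p′`, `P = |p|²`). This file integrates out `λ` by ONE Newton–Leibniz move
(Kontsevich–Zagier's rule (3), through `KZ.exists_band_newtonLeibniz`) with the rational primitive
`G(τ, λ) = 2λ²J(τ)/(1 + λ²P(τ))` (`∂G/∂λ = 4λJ/(1 + λ²P)²`, no pole since `P ≥ 0`), whose boundary
term is `G(τ, 1) − G(τ, 0) = 2J/(1 + P)`; the MAGIC IDENTITY `J(τ)(1 + τ²) = 1 + P(τ)`
(`sphereRadial_magic`, a polynomial identity modulo `R² = 1 + c₁² + c₂²`) turns it into
`2/(1 + τ²)`: the fan is twice an arctangent carrier, i.e. its area is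
`2(arctan τ₂ − arctan τ₁)` (Girard). Closing the fibres `(0, 1) ↦ [0, 1]` costs a null set
(`KZ.of_sub_of_restrict_openBand_mem_relations`), and representations with equal domains whose
integrands agree on the domain are congruent (`KZ.of_sub_of_mem_relations_of_eqOn`).

References: M. Kontsevich, D. Zagier, *Periods* (2001), §1.2 rule (3). No definitions are
introduced.
-/

noncomputable section

open Set MeasureTheory
open Literature.NumberTheory.Transcendental Literature.ModelTheory.ExponentialFields

namespace Summit.KontsevichZagierPeriods.HyperbolicBloch.OffTetraSectorKernel

/-- **The magic identity of the spherical fan.** For the rational parametrisation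
`p(t) = (c₁ + R(1 − t²)/(1 + t²), c₂ + 2Rt/(1 + t²))` of the circle `|z − c|² = R²`,
`R² = 1 + |c|²` (a great circle in the stereographic chart), with `J = p × p′` and `P = |p|²` one
has `J(t)(1 + t²) = 1 + P(t)`, hence `2J/(1 + P) = 2/(1 + t²)`: writing `p = c + R u`,
`u = ((1 − t²), 2t)/(1 + t²)` on the unit circle, `p′ = (2R/(1 + t²)) u^⊥`, so
`J(1 + t²) = 2R(c·u + R)` and `1 + P = 1 + |c|² + 2R c·u + R² = 2R(R + c·u)`. [folklore] -/
theorem sphereRadial_magic (c₁ c₂ R t : ℝ) (hR : R ^ 2 = 1 + c₁ ^ 2 + c₂ ^ 2) :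
    2 * ((c₁ + R * (1 - t ^ 2) / (1 + t ^ 2)) * (2 * R * (1 - t ^ 2) / (1 + t ^ 2) ^ 2) -
        (c₂ + 2 * R * t / (1 + t ^ 2)) * (-4 * R * t / (1 + t ^ 2) ^ 2)) /
      (1 + ((c₁ + R * (1 - t ^ 2) / (1 + t ^ 2)) ^ 2 + (c₂ + 2 * R * t / (1 + t ^ 2)) ^ 2)) =
    2 / (1 + t ^ 2) := by
  have hD : (1 + t ^ 2) ≠ 0 := by positivity
  have hP : (1 + ((c₁ + R * (1 - t ^ 2) / (1 + t ^ 2)) ^ 2 + (c₂ + 2 * R * t / (1 + t ^ 2)) ^ 2))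
      ≠ 0 := by positivity
  have key : ((c₁ + R * (1 - t ^ 2) / (1 + t ^ 2)) * (2 * R * (1 - t ^ 2) / (1 + t ^ 2) ^ 2) -
      (c₂ + 2 * R * t / (1 + t ^ 2)) * (-4 * R * t / (1 + t ^ 2) ^ 2)) * (1 + t ^ 2) =
      1 + ((c₁ + R * (1 - t ^ 2) / (1 + t ^ 2)) ^ 2 + (c₂ + 2 * R * t / (1 + t ^ 2)) ^ 2) := by
    field_simp
    linear_combination (1 + t ^ 2) ^ 2 * hR
  rw [div_eq_div_iff hP hD]
  linear_combination 2 * key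

/-- The Jacobian factor `J(z 0)` and the squared norm `P(z 0)` of the rational parametrisation of a
great circle with real-algebraic data `c₁, c₂, R` are `ℚ`-semialgebraic functions on every
`ℚ`-semialgebraic set of the `(τ, λ)`-plane: they are built from the coordinate `z 0`, rational
constants and the real-algebraic constants (`ℚ`-definable, Kontsevich–Zagier §1.1) by `+`, `−`, `·`
and division by the non-vanishing `1 + (z 0)²`. [folklore] -/
theorem sphereRadial_isSemialgebraicFunOn {S : Set (Fin 2 → ℝ)} (hS : IsSemialgebraic ℚ S)
    {c₁ c₂ R : ℝ} (hc₁ : IsAlgebraic ℚ c₁) (hc₂ : IsAlgebraic ℚ c₂) (hR : IsAlgebraic ℚ R) :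
    IsSemialgebraicFunOn ℚ S (fun z => (c₁ + R * (1 - z 0 ^ 2) / (1 + z 0 ^ 2)) *
        (2 * R * (1 - z 0 ^ 2) / (1 + z 0 ^ 2) ^ 2) -
        (c₂ + 2 * R * z 0 / (1 + z 0 ^ 2)) * (-4 * R * z 0 / (1 + z 0 ^ 2) ^ 2)) ∧
      IsSemialgebraicFunOn ℚ S (fun z => (c₁ + R * (1 - z 0 ^ 2) / (1 + z 0 ^ 2)) ^ 2 +
        (c₂ + 2 * R * z 0 / (1 + z 0 ^ 2)) ^ 2) := by
  have h0 : IsSemialgebraicFunOn ℚ S (fun z => z 0) := isSemialgebraicFunOn_apply hS 0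
  have hc₁' : IsSemialgebraicFunOn ℚ S (fun _ => c₁) := isSemialgebraicFunOn_const_of_isAlgebraic hS hc₁
  have hc₂' : IsSemialgebraicFunOn ℚ S (fun _ => c₂) := isSemialgebraicFunOn_const_of_isAlgebraic hS hc₂
  have hR' : IsSemialgebraicFunOn ℚ S (fun _ => R) := isSemialgebraicFunOn_const_of_isAlgebraic hS hR
  have h2 : IsSemialgebraicFunOn ℚ S (fun _ => (2 : ℝ)) := by
    simpa using isSemialgebraicFunOn_ratCast hS 2
  have hm4 : IsSemialgebraicFunOn ℚ S (fun _ => (-4 : ℝ)) := by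
    simpa using isSemialgebraicFunOn_ratCast hS (-4)
  have hD : IsSemialgebraicFunOn ℚ S (fun z => 1 + z 0 ^ 2) :=
    (isSemialgebraicFunOn_aeval hS (1 + MvPolynomial.X 0 ^ 2)).congr fun z _ => by simp
  have hD2 : IsSemialgebraicFunOn ℚ S (fun z => (1 + z 0 ^ 2) ^ 2) :=
    (isSemialgebraicFunOn_aeval hS ((1 + MvPolynomial.X 0 ^ 2) ^ 2)).congr fun z _ => by simp
  have hN : IsSemialgebraicFunOn ℚ S (fun z => 1 - z 0 ^ 2) :=
    (isSemialgebraicFunOn_aeval hS (1 - MvPolynomial.X 0 ^ 2)).congr fun z _ => by simp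
  have hDne : ∀ z ∈ S, 1 + z 0 ^ 2 ≠ 0 := fun z _ => by positivity
  have hD2ne : ∀ z ∈ S, (1 + z 0 ^ 2) ^ 2 ≠ 0 := fun z _ => by positivity
  have hp₁ : IsSemialgebraicFunOn ℚ S (fun z => c₁ + R * (1 - z 0 ^ 2) / (1 + z 0 ^ 2)) :=
    IsSemialgebraicFunOn.add_holds hc₁' ((IsSemialgebraicFunOn.mul_holds hR' hN).div hD hDne)
  have hp₂ : IsSemialgebraicFunOn ℚ S (fun z => c₂ + 2 * R * z 0 / (1 + z 0 ^ 2)) :=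
    IsSemialgebraicFunOn.add_holds hc₂'
      ((IsSemialgebraicFunOn.mul_holds (IsSemialgebraicFunOn.mul_holds h2 hR') h0).div hD hDne)
  have hq₁ : IsSemialgebraicFunOn ℚ S (fun z => 2 * R * (1 - z 0 ^ 2) / (1 + z 0 ^ 2) ^ 2) :=
    (IsSemialgebraicFunOn.mul_holds (IsSemialgebraicFunOn.mul_holds h2 hR') hN).div hD2 hD2ne
  have hq₂ : IsSemialgebraicFunOn ℚ S (fun z => -4 * R * z 0 / (1 + z 0 ^ 2) ^ 2) :=
    (IsSemialgebraicFunOn.mul_holds (IsSemialgebraicFunOn.mul_holds hm4 hR') h0).div hD2 hD2ne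
  refine ⟨IsSemialgebraicFunOn.sub_holds (IsSemialgebraicFunOn.mul_holds hp₁ hq₁)
    (IsSemialgebraicFunOn.mul_holds hp₂ hq₂), ?_⟩
  exact (IsSemialgebraicFunOn.add_holds (IsSemialgebraicFunOn.mul_holds hp₁ hp₁)
    (IsSemialgebraicFunOn.mul_holds hp₂ hp₂)).congr fun z _ => by
      simp only [Pi.add_apply, Pi.mul_apply]; ring

/-- **Rule (3) along the radial coordinate, abstract form.** Let `J, P : ℝ → ℝ` be continuous,
`P ≥ 0`, with `z ↦ J(z 0)`, `z ↦ P(z 0)` `ℚ`-semialgebraic on the closed band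
`{τ₁ < z 0 < τ₂, 0 ≤ z 1 ≤ 1}` (real-algebraic `τ₁, τ₂`) and `2J/(1 + P) = 2/(1 + t²)`. Then any
representation `W` on the open rectangle `(τ₁, τ₂) × (0, 1)` with integrand
`4λJ(τ)/(1 + λ²P(τ))²` (`τ = z 0`, `λ = z 1`) and any representation `A` on `(τ₁, τ₂)` with
integrand `2/(1 + τ²)` differ by relations: ONE Newton–Leibniz move in the last coordinate with the
primitive `G(τ, λ) = 2λ²J(τ)/(1 + λ²P(τ))` (`∂G/∂λ = 4λJ/(1 + λ²P)²`,
`G(τ, 1) − G(τ, 0) = 2J/(1 + P)`), the null difference between closed and open fibres, and two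
congruences of integrands. [cite: KontsevichZagier2001, §1.2 rule (3)] -/
theorem sphereRadial_core {τ₁ τ₂ : ℝ} (hτ₁ : IsAlgebraic ℚ τ₁) (hτ₂ : IsAlgebraic ℚ τ₂)
    (J P : ℝ → ℝ) (hJc : Continuous J) (hPc : Continuous P) (hP0 : ∀ t, 0 ≤ P t)
    (hJs : IsSemialgebraicFunOn ℚ
      (KZlog.band {q : Fin 1 → ℝ | τ₁ < q 0 ∧ q 0 < τ₂} (fun _ => 0) (fun _ => 1))
      (fun z => J (z 0)))
    (hPs : IsSemialgebraicFunOn ℚ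
      (KZlog.band {q : Fin 1 → ℝ | τ₁ < q 0 ∧ q 0 < τ₂} (fun _ => 0) (fun _ => 1))
      (fun z => P (z 0)))
    (hmagic : ∀ t, 2 * J t / (1 + P t) = 2 / (1 + t ^ 2))
    (W : KZ.IntegralRep 2) (A : KZ.IntegralRep 1)
    (hW : W.domain = {z | τ₁ < z 0 ∧ z 0 < τ₂ ∧ 0 < z 1 ∧ z 1 < 1})
    (hWi : EqOn W.integrand (fun z => 4 * z 1 * J (z 0) / (1 + z 1 ^ 2 * P (z 0)) ^ 2) W.domain)
    (hA : A.domain = {q | τ₁ < q 0 ∧ q 0 < τ₂})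
    (hAi : EqOn A.integrand (fun q => 2 / (1 + q 0 ^ 2)) A.domain) :
    KZ.of W - KZ.of A ∈ KZ.relations := by
  -- coordinates in dimension two
  have hinit : ∀ z : Fin 2 → ℝ, Fin.init z 0 = z 0 := fun _ => rfl
  have hlast : (Fin.last 1 : Fin 2) = 1 := rfl
  set B : Set (Fin 1 → ℝ) := {q | τ₁ < q 0 ∧ q 0 < τ₂} with hBdef
  have hB : IsSemialgebraic ℚ B := isSemialgebraic_logIvl hτ₁ hτ₂
  have ha : IsSemialgebraicFunOn ℚ B (fun _ => (0 : ℝ)) := by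
    simpa using isSemialgebraicFunOn_ratCast hB 0
  have hb : IsSemialgebraicFunOn ℚ B (fun _ => (1 : ℝ)) := by
    simpa using isSemialgebraicFunOn_ratCast hB 1
  set S : Set (Fin 2 → ℝ) := KZlog.band B (fun _ => 0) (fun _ => 1) with hSdef
  have hS : IsSemialgebraic ℚ S := KZlog.isSemialgebraic_band ha hb
  have hden : ∀ s t : ℝ, 0 < 1 + s ^ 2 * P t := fun s t => by
    have := hP0 t
    positivity
  -- semialgebraicity of the integrand and of the primitive on the closed band
  have h1 : IsSemialgebraicFunOn ℚ S (fun z => z 1) := isSemialgebraicFunOn_apply hS 1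
  have h1sq : IsSemialgebraicFunOn ℚ S (fun z => z 1 ^ 2) :=
    (isSemialgebraicFunOn_aeval hS (MvPolynomial.X 1 ^ 2)).congr fun z _ => by simp
  have h2 : IsSemialgebraicFunOn ℚ S (fun _ => (2 : ℝ)) := by
    simpa using isSemialgebraicFunOn_ratCast hS 2
  have h4 : IsSemialgebraicFunOn ℚ S (fun _ => (4 : ℝ)) := by
    simpa using isSemialgebraicFunOn_ratCast hS 4
  have hone : IsSemialgebraicFunOn ℚ S (fun _ => (1 : ℝ)) := by
    simpa using isSemialgebraicFunOn_ratCast hS 1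
  have hE : IsSemialgebraicFunOn ℚ S (fun z => 1 + z 1 ^ 2 * P (z 0)) :=
    IsSemialgebraicFunOn.add_holds hone (IsSemialgebraicFunOn.mul_holds h1sq hPs)
  have hEne : ∀ z ∈ S, 1 + z 1 ^ 2 * P (z 0) ≠ 0 := fun z _ => (hden _ _).ne'
  have hE2 : IsSemialgebraicFunOn ℚ S (fun z => (1 + z 1 ^ 2 * P (z 0)) ^ 2) :=
    (IsSemialgebraicFunOn.mul_holds hE hE).congr fun z _ => (sq _).symm
  have hE2ne : ∀ z ∈ S, (1 + z 1 ^ 2 * P (z 0)) ^ 2 ≠ 0 := fun z _ => (pow_pos (hden _ _) 2).ne'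
  have hGs : IsSemialgebraicFunOn ℚ S
      (fun z => 2 * z 1 ^ 2 * J (z 0) / (1 + z 1 ^ 2 * P (z 0))) :=
    (IsSemialgebraicFunOn.mul_holds (IsSemialgebraicFunOn.mul_holds h2 h1sq) hJs).div hE hEne
  have hfs : IsSemialgebraicFunOn ℚ S
      (fun z => 4 * z 1 * J (z 0) / (1 + z 1 ^ 2 * P (z 0)) ^ 2) :=
    (IsSemialgebraicFunOn.mul_holds (IsSemialgebraicFunOn.mul_holds h4 h1) hJs).div hE2 hE2ne
  -- fibrewise calculus of the primitive `G(τ, λ) = 2λ²J(τ)/(1 + λ²P(τ))`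
  have hcont : ∀ x ∈ B, ContinuousOn
      (fun t : ℝ => 2 * t ^ 2 * J (x 0) / (1 + t ^ 2 * P (x 0))) (Icc 0 1) := by
    intro x _
    have hc : Continuous (fun t : ℝ => 2 * t ^ 2 * J (x 0) / (1 + t ^ 2 * P (x 0))) :=
      Continuous.div (by fun_prop) (by fun_prop) fun t => (hden t (x 0)).ne'
    exact hc.continuousOn
  have hder : ∀ x ∈ B, ∀ t ∈ Ioo (0 : ℝ) 1,
      HasDerivAt (fun s : ℝ => 2 * s ^ 2 * J (x 0) / (1 + s ^ 2 * P (x 0)))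
        (4 * t * J (x 0) / (1 + t ^ 2 * P (x 0)) ^ 2) t := by
    intro x _ t _
    have key := (((hasDerivAt_pow 2 t).const_mul (2 : ℝ)).mul_const (J (x 0))).div
      (((hasDerivAt_pow 2 t).mul_const (P (x 0))).const_add (1 : ℝ)) (hden t (x 0)).ne'
    refine key.congr_deriv ?_
    rw [div_left_inj' (pow_ne_zero 2 (hden t (x 0)).ne')]
    norm_num
    ring
  -- absolute integrability of the integrand on the band: continuous on a compact box
  have hfc : Continuous (fun z : Fin 2 → ℝ => 4 * z 1 * J (z 0) / (1 + z 1 ^ 2 * P (z 0)) ^ 2) :=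
    Continuous.div (by fun_prop) (by fun_prop) fun z => (pow_pos (hden (z 1) (z 0)) 2).ne'
  have hSK : S ⊆ Icc ![τ₁, 0] ![τ₂, 1] := by
    intro z hz
    rw [hSdef, KZlog.mem_band, hBdef, mem_setOf_eq, hinit z, hlast] at hz
    obtain ⟨⟨hz1, hz2⟩, hz3, hz4⟩ := hz
    simp only [mem_Icc, Pi.le_def, Fin.forall_fin_two, Matrix.cons_val_zero, Matrix.cons_val_one]
    exact ⟨⟨hz1.le, hz3⟩, hz2.le, hz4⟩
  have hint : IntegrableOn
      (fun z : Fin 2 → ℝ => 4 * z 1 * J (z 0) / (1 + z 1 ^ 2 * P (z 0)) ^ 2) S :=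
    (hfc.continuousOn.integrableOn_compact isCompact_Icc).mono_set hSK
  -- the boundary term `G(τ, 1) − G(τ, 0) = 2J/(1 + P) = 2/(1 + τ²)`
  have hbdry : ∀ x : Fin 1 → ℝ,
      2 * (1 : ℝ) ^ 2 * J (x 0) / (1 + (1 : ℝ) ^ 2 * P (x 0)) -
        2 * (0 : ℝ) ^ 2 * J (x 0) / (1 + (0 : ℝ) ^ 2 * P (x 0)) = 2 / (1 + x 0 ^ 2) := by
    intro x
    rw [← hmagic (x 0)]
    ring
  have h2B : IsSemialgebraicFunOn ℚ B (fun x => 2 / (1 + x 0 ^ 2)) :=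
    (isSemialgebraicFunOn_aeval_div_aeval hB (MvPolynomial.C 2) (1 + MvPolynomial.X 0 ^ 2)
      (fun x _ => by
        rw [map_add, map_one, map_pow, MvPolynomial.aeval_X]
        positivity)).congr fun x _ => by simp
  have hds : IsSemialgebraicFunOn ℚ B (fun x : Fin 1 → ℝ =>
      2 * (1 : ℝ) ^ 2 * J (x 0) / (1 + (1 : ℝ) ^ 2 * P (x 0)) -
        2 * (0 : ℝ) ^ 2 * J (x 0) / (1 + (0 : ℝ) ^ 2 * P (x 0))) :=
    h2B.congr fun x _ => (hbdry x).symm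
  have h2c : Continuous (fun x : Fin 1 → ℝ => 2 / (1 + x 0 ^ 2)) := by
    fun_prop (disch := intro x; positivity)
  have hBK : B ⊆ Icc (fun _ : Fin 1 => τ₁) (fun _ => τ₂) := by
    intro x hx
    rw [hBdef, mem_setOf_eq] at hx
    rw [mem_Icc, Pi.le_def, Pi.le_def]
    exact ⟨fun i => by fin_cases i; exact hx.1.le, fun i => by fin_cases i; exact hx.2.le⟩
  have hdi : IntegrableOn (fun x : Fin 1 → ℝ =>
      2 * (1 : ℝ) ^ 2 * J (x 0) / (1 + (1 : ℝ) ^ 2 * P (x 0)) -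
        2 * (0 : ℝ) ^ 2 * J (x 0) / (1 + (0 : ℝ) ^ 2 * P (x 0))) B :=
    ((h2c.continuousOn.integrableOn_compact isCompact_Icc).mono_set hBK).congr_fun
      (fun x _ => (hbdry x).symm) (IsSemialgebraic.measurableSet_holds hB)
  -- ONE Newton–Leibniz move (rule (3)) on the closed band
  obtain ⟨rb, rd, hrbd, hrbi, hrdd, hrdi, hrel⟩ := KZ.exists_band_newtonLeibniz hB
    (fun _ => (0 : ℝ)) (fun _ => (1 : ℝ)) ha hb (fun _ _ => zero_le_one)
    (fun z => 2 * z 1 ^ 2 * J (z 0) / (1 + z 1 ^ 2 * P (z 0)))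
    (fun z => 4 * z 1 * J (z 0) / (1 + z 1 ^ 2 * P (z 0)) ^ 2) hGs hfs hcont hder hint hds hdi
  -- closed versus open fibres: a null set
  obtain ⟨r', hr'd, hr'i, hrel'⟩ := KZ.of_sub_of_restrict_openBand_mem_relations ha hb rb hrbd
  -- congruence of `W` with the open band, and of the base with `A`
  have hWr : KZ.of W - KZ.of r' ∈ KZ.relations := by
    refine KZ.of_sub_of_mem_relations_of_eqOn ?_ ?_
    · rw [hr'd, hW]
      ext z
      simp only [mem_setOf_eq, hBdef, hinit, hlast]
      tauto
    · intro z hz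
      rw [hWi hz, hr'i, hrbi]
  have hdA : KZ.of rd - KZ.of A ∈ KZ.relations := by
    refine KZ.of_sub_of_mem_relations_of_eqOn ?_ ?_
    · rw [hA, hrdd]
    · intro x hx
      rw [hrdd] at hx
      have hxA : x ∈ A.domain := by
        rw [hA]
        exact hx
      rw [hrdi, hAi hxA]
      exact hbdry x
  have e : KZ.of W - KZ.of A = (KZ.of W - KZ.of r') - (KZ.of rb - KZ.of r') +
      (KZ.of rb - KZ.of rd) + (KZ.of rd - KZ.of A) := by
    abel
  rw [e]
  exact KZ.relations.add_mem (KZ.relations.add_mem (KZ.relations.sub_mem hWr hrel') hrel) hdA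

/-- **Stub `stub_sphereRadial`** (rule (3), ONE Newton–Leibniz move along `λ`): with the rational
primitive `G(τ, λ) = 2λ²J/(1 + λ²P)` (`P ≥ 0`, no pole),
`[rectangle, 4λJ/(1 + λ²P)²] ≡ [(τ₁, τ₂), G(τ, 1) − G(τ, 0)] = [(τ₁, τ₂), 2J/(1 + P)]
= [(τ₁, τ₂), 2/(1 + τ²)]` by the magic identity `J(1 + τ²) = 1 + P` — the geodesic fan of the
sphere IS twice an arctangent carrier (Girard's theorem in rational form).
[cite: KontsevichZagier2001, §1.2 rule (3)] -/
theorem stub_sphereRadial : ∀ (c₁ c₂ R τ₁ τ₂ : ℝ), IsAlgebraic ℚ c₁ → IsAlgebraic ℚ c₂ → IsAlgebraic ℚ R → IsAlgebraic ℚ τ₁ → IsAlgebraic ℚ τ₂ → 0 < R → R ^ 2 = 1 + c₁ ^ 2 + c₂ ^ 2 → τ₁ < τ₂ → ∀ (W : KZ.IntegralRep 2) (A : KZ.IntegralRep 1), W.domain = {z | τ₁ < z 0 ∧ z 0 < τ₂ ∧ 0 < z 1 ∧ z 1 < 1} → Set.EqOn W.integrand (fun z => 4 * z 1 * ((c₁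 + R * (1 - z 0 ^ 2) / (1 + z 0 ^ 2)) * (2 * R * (1 - z 0 ^ 2) / (1 + z 0 ^ 2) ^ 2) - (c₂ + 2 * R * z 0 / (1 + z 0 ^ 2)) * (-4 * R * z 0 / (1 + z 0 ^ 2) ^ 2)) / (1 + z 1 ^ 2 * ((c₁ + R * (1 - z 0 ^ 2) / (1 + z 0 ^ 2)) ^ 2 + (c₂ + 2 * R * z 0 / (1 + z 0 ^ 2)) ^ 2)) ^ 2) W.domain → A.domain = {q | τ₁ < q 0 ∧ q 0 < τ₂} → Set.EqOn A.integrand (fun q => 2 / (1 + q 0 ^ 2)) A.domain → KZ.of W - KZ.of A ∈ KZ.relations := by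
  intro c₁ c₂ R τ₁ τ₂ hc₁ hc₂ hRa hτ₁ hτ₂ _ hR _ W A hW hWi hA hAi
  have hB : IsSemialgebraic ℚ {q : Fin 1 → ℝ | τ₁ < q 0 ∧ q 0 < τ₂} := isSemialgebraic_logIvl hτ₁ hτ₂
  have hS : IsSemialgebraic ℚ
      (KZlog.band {q : Fin 1 → ℝ | τ₁ < q 0 ∧ q 0 < τ₂} (fun _ => 0) (fun _ => 1)) :=
    KZlog.isSemialgebraic_band (by simpa using isSemialgebraicFunOn_ratCast hB 0)
      (by simpa using isSemialgebraicFunOn_ratCast hB 1)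
  obtain ⟨hJs, hPs⟩ := sphereRadial_isSemialgebraicFunOn hS hc₁ hc₂ hRa
  exact sphereRadial_core hτ₁ hτ₂
    (fun t => (c₁ + R * (1 - t ^ 2) / (1 + t ^ 2)) * (2 * R * (1 - t ^ 2) / (1 + t ^ 2) ^ 2) -
      (c₂ + 2 * R * t / (1 + t ^ 2)) * (-4 * R * t / (1 + t ^ 2) ^ 2))
    (fun t => (c₁ + R * (1 - t ^ 2) / (1 + t ^ 2)) ^ 2 + (c₂ + 2 * R * t / (1 + t ^ 2)) ^ 2)
    (by fun_prop (disch := intro x; positivity)) (by fun_prop (disch := intro x; positivity))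
    (fun t => by positivity) hJs hPs (fun t => sphereRadial_magic c₁ c₂ R t hR) W A hW hWi hA hAi

end Summit.KontsevichZagierPeriods.HyperbolicBloch.OffTetraSectorKernel
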